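import Mathlib.CategoryTheory.Monoidal.Cartesian.Mod
import Mathlib.CategoryTheory.Monoidal.Cartesian.Grp
import Mathlib.CategoryTheory.Limits.Shapes.Pullback.IsPullback.Defs
import Mathlib.CategoryTheory.Limits.Constructions.Over.Connected
import Mathlib.AlgebraicGeometry.Pullbacks
import HarnessLib

/-!
# The triple square of an action: `G ⊗ (G ⊗ X) ≅ (G ⊗ X) ×_X (G ⊗ X)`, its three faces, and — under a torsor square —
# `G ⊗ G ⊗ X ≅ X ×_Q X ×_Q X`

Topic `AlgebraicGeometry/GroupSchemes`; namespace `Literature.AlgebraicGeometry.GroupSchemes.ActionTripleSquare`.  THEOREMS ONLY (no definition,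
no instance, no notation, no named fact).  Cell `pub/hodgecm-mathlib`, P6b wave C, census CENSUS-SD item s19 of the §D line
(`Cruxes/HLiu418/Lines/F0_P6b_MumfordDualFlat.lean` §D): the affine TRIPLE chart `W₃ ⊆ G ×_S G ×_S X` of the cocycle condition of a linearisation
reads `Γ(W₃) ≅ S ⊗_R S ⊗_R S` off two cartesian squares — the torsor square `G ⊗ X ≅ X ×_Q X` (★ `GroupSchemes/TorsorSquareOfKernel`,
★ `RelativeSpec/TorsorQuotientDescent`) and the HYPOTHESIS-FREE square of this file.  `--supports stmt-HodgeConjecture-24832`, count-neutral;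
HC_CM is proved only modulo the printed citations until rung 0 closes; nothing here is about HC.

THE PRINT.  [SGA1] Exp. V §1 (fibre products of `S`-schemes with operators); [SGA3I] Exp. V Thm. 4.1 (iv) («si `(d₀, d₁)` est un couple
d'équivalence, `X₁ → X₀ ×_Y X₀` est un isomorphisme»); [GortzWedhorn2020] Definition 4.44 (p. 117) (action of a group scheme: the associativity
axiom).  For an action `act : G ⊗ X → X` in a cartesian monoidal category `C` (schemes: `C = Over S`):

* §1 **`isPullback_whiskerLeft_snd`** — for EVERY morphism `f : Y → Z`, `G ◁ f` is the base change of `f` along `pr₂`: `IsPullback (G ◁ f) pr₂ pr₂ f`,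
  `G ⊗ Y ≅ (G ⊗ Z) ×_{pr₂, Z, f} Y`; at `f := act`: `G ⊗ (G ⊗ X) ≅ (G ⊗ X) ×_{pr₂, X, act} (G ⊗ X)`.  The three FACES `G ⊗ (G ⊗ X) → G ⊗ X`:
  `pr₂` (drop `g₁`), `G ◁ act` (`(g₁, g₂ · x)`), `α⁻¹ ≫ μ ▷ X` (`(g₁ g₂, x)`), with their compatibilities `whiskerLeft_act_comp_snd`,
  `associator_inv_mul_whiskerRight_comp_snd` (hypothesis-free) and **`associator_inv_mul_whiskerRight_comp_act`** — THE ONE place the action law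
  `hact_mul : (μ ▷ X) ≫ act = α_ ≫ (G ◁ act) ≫ act` enters.  Pasted under a torsor square `hsq : IsPullback act pr₂ π π`:
  **`isPullback_whiskerLeft_act_of_isPullback`** — `G ⊗ G ⊗ X ≅ (X ×_Q X) ×_Q X`.
* §2 the same in `ModObj` dress (`act := γ[G, X]`, the associativity face from Mathlib's `ModObj.mul_smul`): `isPullback_whiskerLeft_smul_snd`,
  `associator_inv_mul_whiskerRight_comp_smul`, `isPullback_whiskerLeft_smul_of_isPullback`.
* PRIOR ART in the tree (not restated, cited): ★ `Motives.isPullback_whiskerLeft_snd (X : SchemeOver K) (f : T' ⟶ T) : IsPullback (X ◁ f).left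
  (snd X T').left (snd X T).left f.left` (`Motives/WhiskerLeftPullback`, over a FIELD and on underlying schemes only, importing the seesaw files) is
  the special case `C = Over (Spec K)` + `Over.forget` of §1's `isPullback_whiskerLeft_snd`; this file proves the general cartesian-monoidal
  statement in 10 lines from the universal property and does not import it.
* §3 SCHEMES (`C = Over S`, `Over.forget` preserves pullbacks): `Over.isPullback_whiskerLeft_snd_left`, `Over.isPullback_whiskerLeft_act_left_of_isPullback`,
  `Over.faces_left` (bare `act` + `hact_mul`), `Over.isPullback_whiskerLeft_smul_snd_left`, `Over.faces_smul_left` (`ModObj` dress).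

## References
* [SGA1] A. Grothendieck, M. Raynaud, *SGA 1*, Exp. V §1.
* [SGA3I] M. Demazure, A. Grothendieck (eds.), *SGA 3, Tome I*, Exp. V Thm. 4.1 (iv).
* [GortzWedhorn2020] U. Görtz, T. Wedhorn, *Algebraic Geometry I*, 2nd ed. (2020), Definition 4.44 (p. 117).
-/

set_option autoImplicit false

noncomputable section

universe v u

open CategoryTheory CategoryTheory.Limits MonoidalCategory CartesianMonoidalCategory
open scoped MonObj

namespace Literature.AlgebraicGeometry.GroupSchemes.ActionTripleSquare

/-! ## §1  The hypothesis-free square and the three faces -/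

section Triple

variable {C : Type u} [Category.{v} C] [CartesianMonoidalCategory C]

/-- **`G ◁ f` is the base change of `f` along the second projection** — hypothesis-free, in any cartesian monoidal category: the square
```
G ⊗ Y --G ◁ f--> G ⊗ Z
  |                |
 snd              snd
  v                v
  Y  -----f----->  Z
```
is CARTESIAN, `G ⊗ Y ≅ (G ⊗ Z) ×_{pr₂, Z, f} Y`.  At `f := act : G ⊗ X → X` it reads `G ⊗ (G ⊗ X) ≅ (G ⊗ X) ×_{pr₂, X, act} (G ⊗ X)`, which pasted
under a torsor square `IsPullback act pr₂ π π` (`G ⊗ X ≅ X ×_Q X`) is the TRIPLE identification `G ⊗ G ⊗ X ≅ X ×_Q X ×_Q X =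
(X ×_Q X) ×_{pr₂, X, pr₁} (X ×_Q X)` — no group law needed for the isomorphism itself. [cite: SGA1, Exp. V §1] [cite: SGA3I, Exp. V Thm. 4.1 (iv)] -/
theorem isPullback_whiskerLeft_snd (G : C) {Y Z' : C} (f : Y ⟶ Z') : IsPullback (G ◁ f) (snd G Y) (snd G Z') f := by
  refine IsPullback.of_isLimit' ⟨whiskerLeft_snd G f⟩ (PullbackCone.IsLimit.mk _ (fun s => lift (s.fst ≫ fst G Z') s.snd)
    (fun s => ?_) (fun s => lift_snd _ _) (fun s m hm₁ hm₂ => ?_))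
  · apply CartesianMonoidalCategory.hom_ext
    · rw [Category.assoc, whiskerLeft_fst, lift_fst]
    · rw [Category.assoc, whiskerLeft_snd, lift_snd_assoc, s.condition]
  · apply CartesianMonoidalCategory.hom_ext
    · rw [lift_fst, ← hm₁, Category.assoc, whiskerLeft_fst]
    · rw [lift_snd, hm₂]

variable {G X : C} (act : G ⊗ X ⟶ X)

/-- **Face `d₂` (drop `x₁`)**: the face `(g₁, g₂ · x) : G ⊗ (G ⊗ X) → G ⊗ X` lies over `act` through the second projections —
`(G ◁ act) ≫ pr₂ = pr₂ ≫ act` (hypothesis-free; the `w` of `isPullback_whiskerLeft_snd`). [cite: SGA1, Exp. V §1] -/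
theorem whiskerLeft_act_comp_snd : (G ◁ act) ≫ snd G X = snd G (G ⊗ X) ≫ act :=
  whiskerLeft_snd G act

/-- **Face `d₁` over `pr₂`**: `((α_ G G X)⁻¹ ≫ μ ▷ X) ≫ pr₂ = pr₂ ≫ pr₂` — the face `(g₁ g₂, x)` keeps the last coordinate (hypothesis-free).
[cite: SGA1, Exp. V §1] -/
theorem associator_inv_mul_whiskerRight_comp_snd [MonObj G] :
    ((α_ G G X).inv ≫ μ[G] ▷ X) ≫ snd G X = snd G (G ⊗ X) ≫ snd G X := by
  rw [Category.assoc, whiskerRight_snd, associator_inv_snd]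

/-- **Face `d₁` over `act` — THE ONE PLACE THE ACTION LAW ENTERS**: `((α_ G G X)⁻¹ ≫ μ ▷ X) ≫ act = (G ◁ act) ≫ act`, i.e.
`(g₁ g₂) · x = g₁ · (g₂ · x)`, from the single law `hact_mul : (μ ▷ X) ≫ act = α_ ≫ (G ◁ act) ≫ act` (Mathlib `ModObj.mul_smul`'s shape; for the
second-factor translation `actSnd` it is `actSnd_mul`). [cite: GortzWedhorn2020, Definition 4.44 (p. 117)] [cite: SGA1, Exp. V §1] -/
theorem associator_inv_mul_whiskerRight_comp_act [MonObj G]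
    (hact_mul : (μ[G] ▷ X) ≫ act = (α_ G G X).hom ≫ (G ◁ act) ≫ act) :
    ((α_ G G X).inv ≫ μ[G] ▷ X) ≫ act = (G ◁ act) ≫ act := by
  rw [Category.assoc, hact_mul, Iso.inv_hom_id_assoc]

/-- **The triple square, pasted**: under a torsor square `hsq : IsPullback act pr₂ π π` (`G ⊗ X ≅ X ×_Q X`), pasting `isPullback_whiskerLeft_snd G act`
on top of `hsq` gives the cartesian rectangle
```
G ⊗ (G ⊗ X) --G ◁ act--> G ⊗ X
     |                       |
 pr₂ ≫ pr₂                 pr₂ ≫ π        i.e.  `IsPullback (G ◁ act) (pr₂ ≫ pr₂) (pr₂ ≫ π) π`,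
     v                       v
     X  ---------π-------->  Q
```
so a point of `G ⊗ (G ⊗ X)` is a point `(g₁, x₂)` of `G ⊗ X ≅ X ×_Q X` together with a point `x₃` of `X` over the same point of `Q`:
`G ⊗ G ⊗ X ≅ (X ×_Q X) ×_Q X`, the triple fibre product read through `hsq` twice. [cite: SGA3I, Exp. V Thm. 4.1 (iv)] [cite: SGA1, Exp. V §1] -/
theorem isPullback_whiskerLeft_act_of_isPullback {Q : C} (π : X ⟶ Q) (hsq : IsPullback act (snd G X) π π) :
    IsPullback (G ◁ act) (snd G (G ⊗ X) ≫ snd G X) (snd G X ≫ π) π :=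
  (isPullback_whiskerLeft_snd G act).paste_vert hsq

end Triple

/-! ## §2  `ModObj` dress (`act := γ[G, X]`; the associativity face is Mathlib's `ModObj.mul_smul`) -/

section TripleMod

variable {C : Type u} [Category.{v} C] [CartesianMonoidalCategory C]

/-- **The generic square for a module object**: `IsPullback (G ◁ γ[G, X]) pr₂ pr₂ γ[G, X]` — «`(g, h, x) ↦ ((g, h · x), (h, x))`», true for EVERY
action, no kernel hypothesis. [cite: SGA1, Exp. V §1] -/
theorem isPullback_whiskerLeft_smul_snd (G X : C) [MonObj G] [ModObj G X] :
    IsPullback (G ◁ γ[G, X]) (snd G (G ⊗ X)) (snd G X) γ[G, X] :=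
  isPullback_whiskerLeft_snd G γ[G, X]

/-- **The associativity face for a module object**: `((α_ G G X)⁻¹ ≫ μ ▷ X) ≫ γ = (G ◁ γ) ≫ γ` — Mathlib's `ModObj.mul_smul` moved across the
associator. [cite: GortzWedhorn2020, Definition 4.44 (p. 117)] -/
theorem associator_inv_mul_whiskerRight_comp_smul (G X : C) [MonObj G] [ModObj G X] :
    ((α_ G G X).inv ≫ μ[G] ▷ X) ≫ γ[G, X] = (G ◁ γ[G, X]) ≫ γ[G, X] := by
  have h := ModObj.mul_smul (M := G) X
  simp only [MonoidalCategory.selfLeftAction_actionHomLeft, MonoidalCategory.selfLeftAction_actionHomRight,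
    MonoidalCategory.selfLeftAction_actionAssocIso] at h
  exact associator_inv_mul_whiskerRight_comp_act γ[G, X] h

/-- The pasted triple square for a module object under a torsor square `hsq : IsPullback γ[G, X] pr₂ π π`.
[cite: SGA3I, Exp. V Thm. 4.1 (iv)] -/
theorem isPullback_whiskerLeft_smul_of_isPullback {G X Q : C} [MonObj G] [ModObj G X] (π : X ⟶ Q)
    (hsq : IsPullback γ[G, X] (snd G X) π π) :
    IsPullback (G ◁ γ[G, X]) (snd G (G ⊗ X) ≫ snd G X) (snd G X ≫ π) π :=
  isPullback_whiskerLeft_act_of_isPullback γ[G, X] π hsq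

end TripleMod

/-! ## §3  Schemes: `C = Over S` -/

section TripleScheme

open _root_.AlgebraicGeometry

variable {S : Scheme.{u}} {G X Q : Over S} (act : G ⊗ X ⟶ X) (π : X ⟶ Q)

/-- **The second pasting square on underlying schemes**: `IsPullback (G ◁ act).left pr₂.left pr₂.left act.left` — `G ×_S (G ×_S X) ≅
(G ×_S X) ×_{pr₂, X, act} (G ×_S X)` (hypothesis-free; `Over.forget` preserves pullbacks).  With the scheme-level torsor square
`hsq : IsPullback act.left (snd G X).left π.left π.left` of ★ `RelativeSpec/TorsorQuotientDescent` this is the affine triple chart's second square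
(`Γ(W₃) ≅ S ⊗_R S ⊗_R S` by ★ `exists_ringEquiv_tensorProduct_kernelPair` applied twice). [cite: SGA1, Exp. V §1] [cite: SGA3I, Exp. V Thm. 4.1 (iv)] -/
theorem Over.isPullback_whiskerLeft_snd_left : IsPullback (G ◁ act).left (snd G (G ⊗ X)).left (snd G X).left act.left :=
  (isPullback_whiskerLeft_snd G act).map (Over.forget S)

/-- The pasted triple square on underlying schemes: `IsPullback (G ◁ act).left (pr₂ ≫ pr₂).left (pr₂ ≫ π).left π.left` from the `Over S`-level
torsor square. [cite: SGA3I, Exp. V Thm. 4.1 (iv)] [cite: SGA1, Exp. V §1] -/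
theorem Over.isPullback_whiskerLeft_act_left_of_isPullback (hsq : IsPullback act (snd G X) π π) :
    IsPullback (G ◁ act).left (snd G (G ⊗ X) ≫ snd G X).left (snd G X ≫ π).left π.left :=
  (isPullback_whiskerLeft_act_of_isPullback act π hsq).map (Over.forget S)

/-- The three face identities on underlying schemes (for the coface maps `S ⊗_R S → S ⊗_R S ⊗_R S` of the affine triple chart): `d₂` over `act`,
`d₁` over `pr₂` (hypothesis-free) and `d₁` over `act` under the action law. [cite: SGA1, Exp. V §1] [cite: GortzWedhorn2020, Definition 4.44 (p. 117)] -/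
theorem Over.faces_left [MonObj G] (hact_mul : (μ[G] ▷ X) ≫ act = (α_ G G X).hom ≫ (G ◁ act) ≫ act) :
    ((G ◁ act).left ≫ (snd G X).left = (snd G (G ⊗ X)).left ≫ act.left) ∧
    (((α_ G G X).inv ≫ μ[G] ▷ X).left ≫ (snd G X).left = (snd G (G ⊗ X)).left ≫ (snd G X).left) ∧
    (((α_ G G X).inv ≫ μ[G] ▷ X).left ≫ act.left = (G ◁ act).left ≫ act.left) := by
  refine ⟨?_, ?_, ?_⟩
  · rw [← Over.comp_left, ← Over.comp_left, whiskerLeft_act_comp_snd]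
  · rw [← Over.comp_left, ← Over.comp_left, associator_inv_mul_whiskerRight_comp_snd]
  · rw [← Over.comp_left, ← Over.comp_left, associator_inv_mul_whiskerRight_comp_act act hact_mul]


/-- `ModObj` dress on underlying schemes: `IsPullback (G ◁ γ[G, X]).left pr₂.left pr₂.left (γ[G, X]).left` (hypothesis-free) — the second square of
the affine triple chart for an `S`-group-scheme action. [cite: SGA1, Exp. V §1] -/
theorem Over.isPullback_whiskerLeft_smul_snd_left (G X : Over S) [MonObj G] [ModObj G X] :
    IsPullback (G ◁ γ[G, X]).left (snd G (G ⊗ X)).left (snd G X).left (γ[G, X]).left :=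
  (isPullback_whiskerLeft_smul_snd G X).map (Over.forget S)

/-- `ModObj` dress, the three face identities on underlying schemes (the associativity face from `ModObj.mul_smul`, hypothesis-free).
[cite: SGA1, Exp. V §1] [cite: GortzWedhorn2020, Definition 4.44 (p. 117)] -/
theorem Over.faces_smul_left (G X : Over S) [MonObj G] [ModObj G X] :
    ((G ◁ γ[G, X]).left ≫ (snd G X).left = (snd G (G ⊗ X)).left ≫ (γ[G, X]).left) ∧
    (((α_ G G X).inv ≫ μ[G] ▷ X).left ≫ (snd G X).left = (snd G (G ⊗ X)).left ≫ (snd G X).left) ∧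
    (((α_ G G X).inv ≫ μ[G] ▷ X).left ≫ (γ[G, X]).left = (G ◁ γ[G, X]).left ≫ (γ[G, X]).left) := by
  have h := ModObj.mul_smul (M := G) X
  simp only [MonoidalCategory.selfLeftAction_actionHomLeft, MonoidalCategory.selfLeftAction_actionHomRight,
    MonoidalCategory.selfLeftAction_actionAssocIso] at h
  exact Over.faces_left γ[G, X] h

end TripleScheme

end Literature.AlgebraicGeometry.GroupSchemes.ActionTripleSquare

end
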